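import Summits.QuantumFields.YangMills.Theorems.LuscherReductionTwistedTraceScalingInnerTwoZone
import Summits.QuantumFields.YangMills.Theorems.LuscherReductionTwistedTraceScalingValleySkeleton
import Summits.QuantumFields.YangMills.Theorems.FemtoCutoffLadderFixedLatticeLawValleyGain
import Summits.QuantumFields.YangMills.Theorems.TwistedTraceScaling.Negative.ValleyProximityThreshold
import Summits.QuantumFields.YangMills.Theorems.TwistedTraceScaling.Negative.InnerPowWindow
import Summits.QuantumFields.YangMills.Theorems.TwistedTraceScaling.Negative.ModelPerturbedNearRigidity
import HarnessLib

/-!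
# Negative lemma R22 (crux `TwistedTraceScaling`, stmt-QuantumFields-20203): the TWO-ZONE split of C4 — the small-action SHELL GAIN is,
# BY NAME, the C3 VALLEY GAIN `V(L)` at the core radius; where it sits relative to the geometry line `4s = q`; the core window `(1/6, 1/3)` is two-sided

Standing disprover `ym-cdisprove-20203-1` (gen 18), vetting lane A's «TWO ZONES» (`…TwistedTraceScalingInnerTwoZone`, p608115 + p608354, COARSE-DESIGN §22):
COARSE-UPPER(L) ⇐ C4-CORE `InnerNoIntruderOneOrbitAt L (β^{−s})` (or the Feshbach package `InnerBOPackageAt L (β^{−s})`, budgets dischargeable iff `s > 1/6`,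
R19–R21) + C4-SHELL `InnerShellGainSmallAt L (β^{−s}) (β^{−1/40}) (β^{−17/20})`, any `0 < s < 1/3`, record `s = 1/4` (`coarseNoIntruderAt_of_core_shellSmall_fortieth`).
Kernel-checked content (no new definition, sorry-free):
* §1 ★★ `shellSmall_record_iff` (`2 ≤ L`, EVERY real `s`): `InnerShellGainSmallAt L (powScale s) (powScale (1/40)) (powScale (17/20)) ↔ ValleyGainAt L (powScale s)
  (powScale (17/20))` — the small-action shell gain at the record IS the C3 target `V(L)` of `…CoarseUpperDefs` at the scales `(β^{−s}, β^{−17/20})` (→: lane A's cut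
  `valleyGainAt_of_shellSmall` with RED's landed `FemtoCutoffLadder.valleyGainAt_ledger` = `V(1/40, 17/20)`; ←: the shell support is a subset of the valley support, `innerShellGainSmallAt_of_valleyGainAt`).
  General form `innerShellGainSmallAt_iff_valleyGainAt` (`ScalesAdmissible L δ δ`, `ValleyGainAt L δ η`).  So the two-zone door is VERBATIM the pre-existing
  `coarseNoIntruderAt_of_valley_oneOrbit_pow₉` at `(p, q) = (s, 17/20)` (example): §22 re-partitions C4 = «V(L) pushed from radius β^{−1/40} down to β^{−s}» + CORE.
* §2 THE GEOMETRY LINE.  Below the line `4s < q` the pushed-down valley gain is the OLD C3 pair at the core radius: `valleyGainAt_pow_of_bo` —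
  `ValleyBOAt L (β^{−s}) (β^{−q}) → ValleyGainAt L (β^{−s}) (β^{−q})` (`0 < s < 1/3`, `4s < q`; GEOM there is lane A's proved `valleyGeomAt_pow`), whence
  `shellSmall_of_bo` and the two-zone door collapses to the pre-§22 `coarseNoIntruderAt_of_bo_geom_pow` (example).  At the record threshold `q = 17/20` the line is
  `s = 17/80`: `valleyGeomAt_core_record_iff` / `valleyLinkProxAt_core_record_iff` — `ValleyGeomAt L (β^{−s}) (β^{−17/20}) ↔ s < 17/80` (R11/R12), so at the RECORD
  core exponent `s = 1/4` BOTH C3 sub-targets are FALSE at the core radius (`not_valleyGeom_linkProx_record_quarter`): the record shell `(β^{−1/4}/2, β^{−1/40}) ∩ {S < 2β^{−17/20}}`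
  contains R10's two-link family — CONSTANT, genuinely non-abelian configurations of size `≍ β^{−q/4} = β^{−17/80}` at that distance from EVERY gauge-toron (R11's mechanism) —
  and is NOT a valley statement; whereas every `s ∈ (1/6, 17/80)` (e.g. `s = 1/5`, `valleyGeom_linkProx_record_fifth`) clears the CORE threshold `1/6` of R19–R21 AND keeps
  the shell inside the proved valley geometry.  On RED's whole window (`q < 8/9`) the reduction window is `1/6 < s < q/4 < 2/9` (`reduction_window`); RED's own floor
  chain cannot supply `V` at any core radius `s ≥ 2/51` (`red_floor_chain_cap`, R16).
* §3 THE CORE WINDOW IS TWO-SIDED: `offDiag_budget_of_one_sixth_lt` / `diag_budget_of_one_sixth_lt` — for `s > 1/6` the R20/R21 budgets of the Feshbach package ARE met by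
  box-uniform first/second-order sizes (R21: violated for every `s < 1/6`, borderline at `1/6`); `not_scalesAdmissible_powScale_of_third_le` — for `s ≥ 1/3` the IMS cut at
  radius `β^{−s}` is NOT admissible (`onionErr ≥ 96π²|E|²β^{2s−1} ≥ 96π²|E|²β^{−1/3}` is not `o(λ_b)`), and `not_bareLambda_dominated_of_third_le` — `β^{−s}` no longer
  dominates the multiples of `λ_b(L³β)` (the `hδ` input of the C3 skeleton); so `1/6 < s < 1/3` is forced on both sides, not a convenience.
* §4 the action-threshold door `innerShellGainAt_of_valleyGainAt` (hypothesis `∀ β, 4|P|δ(β)² < η(β)`) is SHUT at polynomial scales: literally never (`β = 1`,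
  `shell_threshold_hyp_false_pow`), and even eventually iff `q < 2p` (`shell_threshold_eventually_iff`), incompatible with an admissible outer radius `p < 1/3` once
  `q > 2/3` (RED's window): the shell relates to the valley through the CUT (§1), not through the action threshold.
READING (for lane A ym-luscher-20007-p1, OWNER ym-beyond-p1, LEAD twolattice).  No stub is false; nothing here is `¬InnerShellGainSmallAt` or `¬InnerBOPackageAt` — both
are physically sound for `1/6 < s < 1/3` (classical margin `L³β·t⁴ ≥ L³β^{1−4s}/16 ≫ β^{−1/3}`).  The certified points are by name: (i) C4-SHELL(small) at the record =
`V(L)` at `(β^{−s}, β^{−17/20})`, so the §22.4 Schur test «with the BO weight `h·Ω_c`» is a proof of `ValleyGainAt` below RED's radius, for which RED's floor chain is capped at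
`2/51` and lane B's BO/GEOM skeleton applies only below the line `s < q/4`; (ii) at the record `s = 1/4` the shell holds non-valley small fields (R10/R11), so EITHER the weight
is built on the whole one-site small-field ball (the CORE's quartic zero-point physics exported to the shell) OR the record moves to `s ∈ (1/6, q/4)` (`s = 1/5` at
`q = 17/20`; `q → 8/9⁻` widens it to `2/9`) where SHELL ⇐ `ValleyBOAt L (β^{−s}) (β^{−q})` verbatim — a trade-off, since the CORE margin `2s − 1/3` shrinks from `1/6` to `1/15`.
HONEST FRAMING: exponent bookkeeping and by-name reductions about typed sub-targets (C3/C4 of S-BASE) of a child of the CONDITIONAL reduction route (femto rung R2b1);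
`InnerShellGainSmallAt`, `InnerBOPackageAt`, `ValleyBOAt`, C3/C4, the stubs and the crux stay OPEN; not `¬TwistedTraceScaling`, not infinite volume, not a gap, not Clay.
Sorry-free, no new definition; axioms ⊆ {propext, Classical.choice, Quot.sound}.
-/

set_option autoImplicit false

noncomputable section

open Real
open Literature.MathematicalPhysics.QuantumFieldTheory
open Literature.MathematicalPhysics.QuantumLattice
open Summit.QuantumFields.YangMills.Theorems.FemtoTransferGap

namespace Summit.QuantumFields.YangMills.Theorems.TwistedTraceScaling.Negative.R22

variable {L : ℕ} [NeZero L]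

/-! ## §1 The small-action SHELL GAIN is the VALLEY GAIN at the core radius -/

/-- The shell support `{S < 2η} ∩ {∃ z, orbitDist(τ_z U) < δ} ∩ {∀ z, δc/2 < orbitDist(τ_z U)}` is contained in the valley support `{S < 2η} ∩ {∀ z, δc/2 < orbitDist(τ_z U)}`
at the core radius: `ValleyGainAt L δc η → InnerShellGainSmallAt L δc δ η` for EVERY outer radius `δ`. [folklore] -/
theorem innerShellGainSmallAt_of_valleyGainAt {δc δ η : ℝ → ℝ} (hV : ValleyGainAt L δc η) : InnerShellGainSmallAt L δc δ η := by
  intro A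
  obtain ⟨β0, h⟩ := hV A
  exact ⟨β0, fun β hβ φ hφ hsupp => h β hβ φ hφ fun U hU => ⟨(hsupp U hU).1, (hsupp U hU).2.2⟩⟩

/-- ★★ **SHELL(small) ≡ VALLEY GAIN at the core radius**, given an admissible intermediate cut radius `δ` and the valley gain at `δ`:
`InnerShellGainSmallAt L δc δ η ↔ ValleyGainAt L δc η` (→ is lane A's `valleyGainAt_of_shellSmall`). [cite: Luscher1983, §3] -/
theorem innerShellGainSmallAt_iff_valleyGainAt {δc δ η : ℝ → ℝ} (hS : ScalesAdmissible L δ δ) (hV : ValleyGainAt L δ η) :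
    InnerShellGainSmallAt L δc δ η ↔ ValleyGainAt L δc η :=
  ⟨fun hSh => valleyGainAt_of_shellSmall hS hSh hV, innerShellGainSmallAt_of_valleyGainAt⟩

/-- Polynomial radii: `InnerShellGainSmallAt L (β^{−s}) (β^{−p}) (β^{−q}) ↔ ValleyGainAt L (β^{−s}) (β^{−q})` whenever `0 < p < 1/3` and `V(p, q)` holds. [cite: Luscher1983, §3] -/
theorem innerShellGainSmallAt_pow_iff {s p q : ℝ} (hp0 : 0 < p) (hp : p < 1 / 3) (hV : ValleyGainAt L (powScale p) (powScale q)) :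
    InnerShellGainSmallAt L (powScale s) (powScale p) (powScale q) ↔ ValleyGainAt L (powScale s) (powScale q) :=
  innerShellGainSmallAt_iff_valleyGainAt (scalesAdmissible_powScale hp0 hp) hV

/-- ★★ **THE RECORD SHELL IS `V(L)` AT THE CORE RADIUS** (`2 ≤ L`, every real `s`):
`InnerShellGainSmallAt L (β^{−s}) (β^{−1/40}) (β^{−17/20}) ↔ ValleyGainAt L (β^{−s}) (β^{−17/20})` (RED at the record is lane B's landed
`FemtoCutoffLadder.valleyGainAt_ledger`). [cite: Luscher1983, §3] -/
theorem shellSmall_record_iff (hL : 2 ≤ L) (s : ℝ) :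
    InnerShellGainSmallAt L (powScale s) (powScale (1 / 40)) (powScale (17 / 20)) ↔ ValleyGainAt L (powScale s) (powScale (17 / 20)) :=
  innerShellGainSmallAt_pow_iff (by norm_num) (by norm_num) (FemtoCutoffLadder.valleyGainAt_ledger hL)

/-- Hence the two-zone door `coarseNoIntruderAt_of_core_shellSmall_fortieth` is VERBATIM the pre-existing `coarseNoIntruderAt_of_valley_oneOrbit_pow₉` at `(p, q) = (s, 17/20)`. -/
example (hL : 2 ≤ L) {s : ℝ} (hs0 : 0 < s) (hs : s < 1 / 3) (hCore : InnerNoIntruderOneOrbitAt L (powScale s))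
    (hShell : InnerShellGainSmallAt L (powScale s) (powScale (1 / 40)) (powScale (17 / 20))) :
    ∀ k : ℕ, ∀ d : ℝ, d < levelGap k → ∃ lam0 : ℝ, 0 < lam0 ∧ ∀ lam : ℝ, 0 < lam → lam ≤ lam0 →
      ∀ β : ℝ, InFemtoWindow lam β L →
        levelValue su2Rep L β k ≤ Real.exp (-(d * luscherLambda β L) / L) * levelValue su2Rep L β 0 :=
  coarseNoIntruderAt_of_valley_oneOrbit_pow₉ hs0 hs (by norm_num) ((shellSmall_record_iff hL s).1 hShell) hCore

/-! ## §2 The geometry line `4s = q` -/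

/-- ★ **Below the line the pushed-down valley gain is the OLD C3 pair at the core radius**: for `0 < s < 1/3`, `4s < q`,
`ValleyBOAt L (β^{−s}) (β^{−q}) → ValleyGainAt L (β^{−s}) (β^{−q})` — lane A's skeleton `valleyKernelRowBoundAt_of_bo_geom` with GEOM discharged by `valleyGeomAt_pow`
and `hδ` by `powScale_dominates_bareLambda`. [cite: Luscher1983, §3] [cite: LuscherMunster1984, §2] -/
theorem valleyGainAt_pow_of_bo {s q : ℝ} (hs0 : 0 < s) (hs : s < 1 / 3) (hsq : 4 * s < q) (hBO : ValleyBOAt L (powScale s) (powScale q)) :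
    ValleyGainAt L (powScale s) (powScale q) :=
  valleyGainAt_of_kernelRowBound
    (valleyKernelRowBoundAt_of_bo_geom hBO (valleyGeomAt_pow hs0 hsq) (fun β => powScale_pos s β) (powScale_dominates_bareLambda hs))

/-- Below the line the small-action SHELL follows from `ValleyBOAt` at the core radius (any outer radius `p`). [cite: Luscher1983, §3] -/
theorem shellSmall_of_bo {s p q : ℝ} (hs0 : 0 < s) (hs : s < 1 / 3) (hsq : 4 * s < q) (hBO : ValleyBOAt L (powScale s) (powScale q)) :
    InnerShellGainSmallAt L (powScale s) (powScale p) (powScale q) :=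
  innerShellGainSmallAt_of_valleyGainAt (valleyGainAt_pow_of_bo hs0 hs hsq hBO)

/-- … and the two-zone door collapses to the pre-§22 `coarseNoIntruderAt_of_bo_geom_pow` (`0 < s`, `4s < q < 8/9`). -/
example {s q : ℝ} (hs0 : 0 < s) (hsq : 4 * s < q) (hq : q < 8 / 9) (hBO : ValleyBOAt L (powScale s) (powScale q))
    (hCore : InnerNoIntruderOneOrbitAt L (powScale s)) :
    ∀ k : ℕ, ∀ d : ℝ, d < levelGap k → ∃ lam0 : ℝ, 0 < lam0 ∧ ∀ lam : ℝ, 0 < lam → lam ≤ lam0 →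
      ∀ β : ℝ, InFemtoWindow lam β L →
        levelValue su2Rep L β k ≤ Real.exp (-(d * luscherLambda β L) / L) * levelValue su2Rep L β 0 :=
  coarseNoIntruderAt_of_bo_geom_pow hs0 (by linarith) hq hBO (valleyGeomAt_pow hs0 hsq) hCore

/-- On RED's whole window (`q < 8/9`) the by-name reduction window for the core exponent is `s < q/4 < 2/9`, and it meets the CORE threshold `1/6` of R19–R21. [folklore] -/
theorem reduction_window {s q : ℝ} (hsq : 4 * s < q) (hq : q < 8 / 9) : s < 2 / 9 ∧ (1 : ℝ) / 6 < 2 / 9 :=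
  ⟨by linarith, by norm_num⟩

/-- RED's own floor chain (`valleyGainAt_of_floor_pow ∘ valleyFloorAt_of_idealCmp_pow ∘ riccatiN_idealCmp_pow` with `p := s`) cannot supply `V` at any core radius of the window:
its exponent hypotheses force `s < 2/51 < 1/6` (R16). [folklore] -/
theorem red_floor_chain_cap {s q r m : ℝ} (hq : q < 8 / 9) (hrq : 2 * r < q - m / 2) (hsm : s < m / 2) (hC : 1 + 3 * m - 3 * r < -s) :
    s < 2 / 51 ∧ (2 : ℝ) / 51 < 1 / 6 :=
  ⟨(R16.innerPow_hypotheses_window hq hrq hsm hC).1, by norm_num⟩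

/-- ★ At the record threshold `q = 17/20` the geometry line is `s = 17/80`: `ValleyGeomAt L (β^{−s}) (β^{−17/20}) ↔ s < 17/80` (`2 ≤ L`, `0 < s`; R11/R12 + lane A). [cite: Luscher1983, §2–§3] -/
theorem valleyGeomAt_core_record_iff (hL : 2 ≤ L) {s : ℝ} (hs0 : 0 < s) :
    ValleyGeomAt L (powScale s) (powScale (17 / 20)) ↔ s < 17 / 80 := by
  rw [R12.valleyGeomAt_pow_iff L hL hs0 (by norm_num)]
  constructor <;> intro h <;> linarith

/-- The same line for the LINK-PROXIMITY sub-target (every `L ≥ 1`). [cite: Luscher1983, §2] -/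
theorem valleyLinkProxAt_core_record_iff {s : ℝ} (hs0 : 0 < s) :
    ValleyLinkProxAt L (powScale s) (powScale (17 / 20)) ↔ s < 17 / 80 := by
  rw [R12.valleyLinkProxAt_pow_iff L hs0 (by norm_num)]
  constructor <;> intro h <;> linarith

/-- ★ **AT THE RECORD CORE EXPONENT `s = 1/4` BOTH C3 SUB-TARGETS FAIL AT THE CORE RADIUS** (`2 ≤ L`): the record shell is not a valley statement. [cite: Luscher1983, §2–§3] -/
theorem not_valleyGeom_linkProx_record_quarter (hL : 2 ≤ L) :
    ¬ ValleyGeomAt L (powScale (1 / 4)) (powScale (17 / 20)) ∧ ¬ ValleyLinkProxAt L (powScale (1 / 4)) (powScale (17 / 20)) :=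
  ⟨fun h => absurd ((valleyGeomAt_core_record_iff hL (by norm_num)).1 h) (by norm_num),
    fun h => absurd ((valleyLinkProxAt_core_record_iff (L := L) (by norm_num)).1 h) (by norm_num)⟩

/-- … whereas `s = 1/5 ∈ (1/6, 17/80)` clears the CORE threshold and keeps both sub-targets at the core radius (`2 ≤ L`). [cite: Luscher1983, §2–§3] -/
theorem valleyGeom_linkProx_record_fifth (hL : 2 ≤ L) :
    (1 : ℝ) / 6 < 1 / 5 ∧ ValleyGeomAt L (powScale (1 / 5)) (powScale (17 / 20)) ∧ ValleyLinkProxAt L (powScale (1 / 5)) (powScale (17 / 20)) :=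
  ⟨by norm_num, (valleyGeomAt_core_record_iff hL (by norm_num)).2 (by norm_num),
    (valleyLinkProxAt_core_record_iff (L := L) (by norm_num)).2 (by norm_num)⟩

/-- Below the record line the record SHELL follows from `ValleyBOAt` at the core radius: `0 < s < 17/80`. [cite: Luscher1983, §3] -/
theorem shellSmall_record_of_bo {s : ℝ} (hs0 : 0 < s) (hs : s < 17 / 80) (hBO : ValleyBOAt L (powScale s) (powScale (17 / 20))) :
    InnerShellGainSmallAt L (powScale s) (powScale (1 / 40)) (powScale (17 / 20)) :=
  shellSmall_of_bo hs0 (by linarith) (by linarith) hBO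

/-! ## §3 The core window `1/6 < s < 1/3` is two-sided -/

section Window

variable (L)

/-- ★ **Above `1/6` the OFF-DIAGONAL budget is met by a box-uniform first-order size** (converse side of R21's `offDiag_budget_false_of_first_order`):
for `1/6 < p`, any real `κ` and `ε, θ > 0`, eventually `(κ·β^{−p})² ≤ εθ·λ_b(L³β)/16`. [cite: Luscher1983, §3] -/
theorem offDiag_budget_of_one_sixth_lt {p : ℝ} (hp : 1 / 6 < p) (κ : ℝ) {ε θ : ℝ} (hε : 0 < ε) (hθ : 0 < θ) :
    ∃ β0 : ℝ, ∀ β : ℝ, β0 ≤ β → ∃ b : ℝ, κ * powScale p β ≤ b ∧ b ^ 2 ≤ ε * θ * bareLambda ((L : ℝ) ^ 3 * β) / 16 := by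
  have hL : (0 : ℝ) < (L : ℝ) ^ 3 := by
    have : (0 : ℝ) < L := by exact_mod_cast Nat.pos_of_ne_zero (NeZero.ne L)
    positivity
  set M : ℝ := ε * θ * (2 / (L : ℝ) ^ 3) ^ ((1 : ℝ) / 3) / 16 with hM
  have hM0 : 0 < M := by rw [hM]; positivity
  have hq : 0 < 2 * p - 1 / 3 := by linarith
  obtain ⟨β0, h⟩ := rpow_neg_eventually_le hq (M := M / (κ ^ 2 + 1)) (by positivity)
  refine ⟨β0, fun β hβ => ⟨κ * powScale p β, le_rfl, ?_⟩⟩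
  obtain ⟨hβ1, hle⟩ := h β hβ
  have hβ0 : 0 < β := by linarith
  rw [mul_pow, R21.powScale_sq, powScale_eq hβ1, bareLambda_cube_eq (L := L) hβ0]
  have hsplit : β ^ (-(2 * p)) = β ^ (-(2 * p - 1 / 3)) * β ^ (-(1 : ℝ) / 3) := by
    rw [← Real.rpow_add hβ0]; congr 1; ring
  rw [hsplit]
  have hb3 : 0 < β ^ (-(1 : ℝ) / 3) := Real.rpow_pos_of_pos hβ0 _
  have hκ2 : 0 ≤ κ ^ 2 := sq_nonneg κ
  have h1 : κ ^ 2 * β ^ (-(2 * p - 1 / 3)) ≤ M := by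
    have h2 : κ ^ 2 * (M / (κ ^ 2 + 1)) ≤ M := by
      rw [mul_div_assoc', div_le_iff₀ (by positivity)]; nlinarith
    exact (mul_le_mul_of_nonneg_left hle hκ2).trans h2
  calc κ ^ 2 * (β ^ (-(2 * p - 1 / 3)) * β ^ (-(1 : ℝ) / 3)) = κ ^ 2 * β ^ (-(2 * p - 1 / 3)) * β ^ (-(1 : ℝ) / 3) := by ring
    _ ≤ M * β ^ (-(1 : ℝ) / 3) := mul_le_mul_of_nonneg_right h1 hb3.le
    _ = ε * θ * ((2 / (L : ℝ) ^ 3) ^ ((1 : ℝ) / 3) * β ^ (-(1 : ℝ) / 3)) / 16 := by rw [hM]; ring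

/-- ★ **Above `1/6` the DIAGONAL budget is met by a box-uniform second-order size** (converse side of R21's `diag_budget_false_of_second_order`):
for `1/6 < p`, any real `κ` and `ε > 0`, eventually `κ·β^{−2p} ≤ ε·λ_b(L³β)`. [cite: Luscher1983, §3] -/
theorem diag_budget_of_one_sixth_lt {p : ℝ} (hp : 1 / 6 < p) (κ : ℝ) {ε : ℝ} (hε : 0 < ε) :
    ∃ β0 : ℝ, ∀ β : ℝ, β0 ≤ β → ∃ η₂ : ℝ, κ * powScale (2 * p) β ≤ η₂ ∧ η₂ ≤ ε * bareLambda ((L : ℝ) ^ 3 * β) := by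
  have hL : (0 : ℝ) < (L : ℝ) ^ 3 := by
    have : (0 : ℝ) < L := by exact_mod_cast Nat.pos_of_ne_zero (NeZero.ne L)
    positivity
  set M : ℝ := ε * (2 / (L : ℝ) ^ 3) ^ ((1 : ℝ) / 3) with hM
  have hM0 : 0 < M := by rw [hM]; positivity
  have hq : 0 < 2 * p - 1 / 3 := by linarith
  obtain ⟨β0, h⟩ := rpow_neg_eventually_le hq (M := M / (|κ| + 1)) (by positivity)
  refine ⟨β0, fun β hβ => ⟨κ * powScale (2 * p) β, le_rfl, ?_⟩⟩
  obtain ⟨hβ1, hle⟩ := h β hβ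
  have hβ0 : 0 < β := by linarith
  rw [powScale_eq hβ1, bareLambda_cube_eq (L := L) hβ0]
  have hsplit : β ^ (-(2 * p)) = β ^ (-(2 * p - 1 / 3)) * β ^ (-(1 : ℝ) / 3) := by
    rw [← Real.rpow_add hβ0]; congr 1; ring
  rw [hsplit]
  have hb3 : 0 < β ^ (-(1 : ℝ) / 3) := Real.rpow_pos_of_pos hβ0 _
  have hbq : 0 < β ^ (-(2 * p - 1 / 3)) := Real.rpow_pos_of_pos hβ0 _
  have h1 : κ * β ^ (-(2 * p - 1 / 3)) ≤ M := by
    have hk : κ * β ^ (-(2 * p - 1 / 3)) ≤ |κ| * β ^ (-(2 * p - 1 / 3)) := mul_le_mul_of_nonneg_right (le_abs_self κ) hbq.le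
    have h2 : |κ| * (M / (|κ| + 1)) ≤ M := by
      rw [mul_div_assoc', div_le_iff₀ (by positivity)]; nlinarith [abs_nonneg κ]
    exact hk.trans ((mul_le_mul_of_nonneg_left hle (abs_nonneg κ)).trans h2)
  calc κ * (β ^ (-(2 * p - 1 / 3)) * β ^ (-(1 : ℝ) / 3)) = κ * β ^ (-(2 * p - 1 / 3)) * β ^ (-(1 : ℝ) / 3) := by ring
    _ ≤ M * β ^ (-(1 : ℝ) / 3) := mul_le_mul_of_nonneg_right h1 hb3.le
    _ = ε * ((2 / (L : ℝ) ^ 3) ^ ((1 : ℝ) / 3) * β ^ (-(1 : ℝ) / 3)) := by rw [hM]; ring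

/-- The first IMS defect term alone bounds the onion error from below: `(1/2)|E|²(3/β)(8π/δ)² ≤ onionErr L β δ η` (`β > 0`). [folklore] -/
theorem ims_delta_term_le_onionErr {β : ℝ} (hβ : 0 < β) (δ η : ℝ) :
    (1 / 2) * ((Fintype.card (Edge 3 L) : ℝ) ^ 2 * (3 / β) * (8 * π / δ) ^ 2) ≤ onionErr L β δ η := by
  unfold onionErr
  have hexp : 0 ≤ Real.exp (-(β * η)) := (Real.exp_pos _).le
  have hc : 0 ≤ (1 / 2) * ((Fintype.card (Edge 3 L) : ℝ) ^ 2 * (3 / β)) := by positivity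
  have hP : 0 ≤ (4 * π * (Fintype.card (Plaquette 3 L) : ℝ) / η) ^ 2 := sq_nonneg _
  nlinarith [mul_nonneg hc hP]

/-- ★ **For `p ≥ 1/3` the IMS cut at radius `β^{−p}` is NOT admissible**: `¬ ScalesAdmissible L (powScale p) (powScale p)` — the first IMS defect is
`96π²|E|²·β^{2p−1} ≥ 96π²|E|²·β^{−1/3}`, a FIXED multiple of `λ_b(L³β)·c_L ≍ β^{−1/3}`, while admissibility asks `o(λ_b·c_L)` (lane A's `scalesAdmissible_powScale` is
exactly `0 < p < 1/3`). [cite: SimonB1983DiscreteSpectrum, §3] -/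
theorem not_scalesAdmissible_powScale_of_third_le {p : ℝ} (hp : 1 / 3 ≤ p) : ¬ ScalesAdmissible L (powScale p) (powScale p) := by
  rintro ⟨-, -, hErr⟩
  have hL0 : (0 : ℝ) < L := by exact_mod_cast Nat.pos_of_ne_zero (NeZero.ne L)
  have hL : (0 : ℝ) < (L : ℝ) ^ 3 := by positivity
  have hcL := uniformFloorConst_pos (L := L)
  have hE : (1 : ℝ) ≤ Fintype.card (Edge 3 L) := by
    exact_mod_cast Fintype.card_pos_iff.2 ⟨((fun _ => (0 : ZMod L)), (0 : Fin 3))⟩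
  set D : ℝ := 96 * π ^ 2 * (Fintype.card (Edge 3 L) : ℝ) ^ 2 with hD
  have hD0 : 0 < D := by rw [hD]; positivity
  set c : ℝ := (2 / (L : ℝ) ^ 3) ^ ((1 : ℝ) / 3) * uniformFloorConst L with hc
  have hc0 : 0 < c := by rw [hc]; positivity
  obtain ⟨β0, h⟩ := hErr (D / 2 / c) (by positivity)
  have main := h (max β0 1) (le_max_left _ _)
  have hβ1 : (1 : ℝ) ≤ max β0 1 := le_max_right _ _
  have hβ0' : (0 : ℝ) < max β0 1 := by linarith
  rw [powScale_eq hβ1, bareLambda_cube_eq (L := L) hβ0'] at main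
  set β : ℝ := max β0 1 with hβdef
  -- the lower bound `D·β^{2p−1} ≤ onionErr`
  have hlow : D * β ^ (2 * p - 1) ≤ onionErr L β (β ^ (-p)) (β ^ (-p)) := by
    refine le_trans (le_of_eq ?_) (ims_delta_term_le_onionErr L hβ0' (β ^ (-p)) (β ^ (-p)))
    have hinv : (β ^ (-p))⁻¹ = β ^ p := by rw [Real.rpow_neg hβ0'.le, inv_inv]
    have e2 : β ^ (2 * p - 1) = (β ^ p) ^ 2 / β := by
      rw [Real.rpow_sub_one hβ0'.ne', show 2 * p = p * 2 by ring, Real.rpow_mul hβ0'.le, Real.rpow_two]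
    rw [e2, div_eq_mul_inv (8 * π), hinv, hD]
    field_simp
    ring
  -- `β^{−1/3} ≤ β^{2p−1}` for `β ≥ 1`, `p ≥ 1/3`
  have hmono : β ^ (-(1 : ℝ) / 3) ≤ β ^ (2 * p - 1) := Real.rpow_le_rpow_of_exponent_le hβ1 (by linarith)
  have hb3 : 0 < β ^ (-(1 : ℝ) / 3) := Real.rpow_pos_of_pos hβ0' _
  have e3 : D / 2 / c * ((2 / (L : ℝ) ^ 3) ^ ((1 : ℝ) / 3) * β ^ (-(1 : ℝ) / 3)) * uniformFloorConst L = D / 2 * β ^ (-(1 : ℝ) / 3) := by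
    rw [hc]; field_simp
  rw [e3] at main
  have h4 : D * β ^ (-(1 : ℝ) / 3) ≤ D * β ^ (2 * p - 1) := mul_le_mul_of_nonneg_left hmono hD0.le
  nlinarith

/-- ★ **For `p ≥ 1/3` the radius `β^{−p}` no longer dominates the multiples of `λ_b(L³β)`** (the `hδ` input of lane A's `valleyKernelRowBoundAt_of_bo_geom`;
converse side of `powScale_dominates_bareLambda`, which is exactly `p < 1/3`). [folklore] -/
theorem not_bareLambda_dominated_of_third_le {p : ℝ} (hp : 1 / 3 ≤ p) :
    ¬ ∀ M : ℝ, ∃ β0 : ℝ, ∀ β : ℝ, β0 ≤ β → M * bareLambda ((L : ℝ) ^ 3 * β) ≤ powScale p β := by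
  intro h
  have hL0 : (0 : ℝ) < L := by exact_mod_cast Nat.pos_of_ne_zero (NeZero.ne L)
  have hL : (0 : ℝ) < (L : ℝ) ^ 3 := by positivity
  set c : ℝ := (2 / (L : ℝ) ^ 3) ^ ((1 : ℝ) / 3) with hc
  have hc0 : 0 < c := by rw [hc]; positivity
  obtain ⟨β0, hβ0⟩ := h (2 / c)
  have main := hβ0 (max β0 1) (le_max_left _ _)
  have hβ1 : (1 : ℝ) ≤ max β0 1 := le_max_right _ _
  have hβ0' : (0 : ℝ) < max β0 1 := by linarith
  rw [bareLambda_cube_eq (L := L) hβ0', powScale_eq hβ1] at main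
  set β : ℝ := max β0 1 with hβdef
  have e : 2 / c * (c * β ^ (-(1 : ℝ) / 3)) = 2 * β ^ (-(1 : ℝ) / 3) := by field_simp
  rw [e] at main
  have hmono : β ^ (-p) ≤ β ^ (-(1 : ℝ) / 3) := Real.rpow_le_rpow_of_exponent_le hβ1 (by linarith)
  have hpos : 0 < β ^ (-p) := Real.rpow_pos_of_pos hβ0' _
  linarith

/-- The window of lane A's two-zone door, two-sidedly: budgets need `1/6 < s` (R21 + the two lemmas above), the cut needs `s < 1/3`; the record `s = 1/4` and `s = 1/5` lie inside. [folklore] -/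
theorem core_window_record : (1 : ℝ) / 6 < 1 / 4 ∧ (1 : ℝ) / 4 < 1 / 3 ∧ (1 : ℝ) / 6 < 1 / 5 ∧ (1 : ℝ) / 5 < 17 / 80 ∧ (17 : ℝ) / 80 < 1 / 4 := by
  norm_num

end Window

/-! ## §4 The action-threshold door is shut at polynomial scales -/

section Threshold

variable (L)

/-- `powScale p 1 = 1`. [folklore] -/
theorem powScale_one (p : ℝ) : powScale p 1 = 1 := by
  unfold powScale
  rw [max_self, Real.one_rpow]

/-- The hypothesis `∀ β, 4|P|·δ(β)² < η(β)` of lane A's `innerShellGainAt_of_valleyGainAt` is NEVER met by polynomial scales (at `β = 1` both sides are `1`, and `|P| ≥ 1`). [folklore] -/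
theorem shell_threshold_hyp_false_pow (p q : ℝ) :
    ¬ ∀ β : ℝ, 4 * (Fintype.card (Plaquette 3 L) : ℝ) * powScale p β ^ 2 < powScale q β := by
  intro h
  have hne : Nonempty (Plaquette 3 L) := ⟨((fun _ => (0 : ZMod L)), ⟨((0 : Fin 3), (1 : Fin 3)), by decide⟩)⟩
  have hP : (1 : ℝ) ≤ Fintype.card (Plaquette 3 L) := by exact_mod_cast Fintype.card_pos_iff.2 hne
  have h1 := h 1
  rw [powScale_one, powScale_one] at h1
  linarith

/-- ★ Its eventual repair holds iff `q < 2p`: `(∃ β0, ∀ β ≥ β0, 4|P|·(β^{−p})² < β^{−q}) ↔ q < 2p`. [folklore] -/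
theorem shell_threshold_eventually_iff {p q : ℝ} :
    (∃ β0 : ℝ, ∀ β : ℝ, β0 ≤ β → 4 * (Fintype.card (Plaquette 3 L) : ℝ) * powScale p β ^ 2 < powScale q β) ↔ q < 2 * p := by
  have hne : Nonempty (Plaquette 3 L) := ⟨((fun _ => (0 : ZMod L)), ⟨((0 : Fin 3), (1 : Fin 3)), by decide⟩)⟩
  have hP : (1 : ℝ) ≤ Fintype.card (Plaquette 3 L) := by exact_mod_cast Fintype.card_pos_iff.2 hne
  constructor
  · rintro ⟨β0, h⟩
    by_contra hq
    push Not at hq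
    have h1 := h (max β0 1) (le_max_left _ _)
    have hβ1 : (1 : ℝ) ≤ max β0 1 := le_max_right _ _
    have hβ0' : (0 : ℝ) < max β0 1 := by linarith
    rw [R21.powScale_sq, powScale_eq hβ1, powScale_eq hβ1] at h1
    have hmono : (max β0 1) ^ (-q) ≤ (max β0 1) ^ (-(2 * p)) := Real.rpow_le_rpow_of_exponent_le hβ1 (by linarith)
    have hpos : 0 < (max β0 1) ^ (-(2 * p)) := Real.rpow_pos_of_pos hβ0' _
    nlinarith
  · intro hq
    have hd : 0 < 2 * p - q := by linarith
    obtain ⟨β0, h⟩ := rpow_neg_eventually_le hd (M := 1 / (4 * (Fintype.card (Plaquette 3 L) : ℝ) + 1)) (by positivity)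
    refine ⟨β0, fun β hβ => ?_⟩
    obtain ⟨hβ1, hle⟩ := h β hβ
    have hβ0' : 0 < β := by linarith
    rw [R21.powScale_sq, powScale_eq hβ1, powScale_eq hβ1]
    have hsplit : β ^ (-(2 * p)) = β ^ (-(2 * p - q)) * β ^ (-q) := by
      rw [← Real.rpow_add hβ0']; congr 1; ring
    rw [hsplit]
    have hbq : 0 < β ^ (-q) := Real.rpow_pos_of_pos hβ0' _
    have h4 : 4 * (Fintype.card (Plaquette 3 L) : ℝ) * β ^ (-(2 * p - q)) < 1 := by
      have h5 : 4 * (Fintype.card (Plaquette 3 L) : ℝ) * (1 / (4 * (Fintype.card (Plaquette 3 L) : ℝ) + 1)) < 1 := by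
        rw [mul_one_div, div_lt_one (by positivity)]; linarith
      exact lt_of_le_of_lt (mul_le_mul_of_nonneg_left hle (by positivity)) h5
    nlinarith

/-- … and `q < 2p` is incompatible with an admissible outer radius `p < 1/3` once `q > 2/3` (RED's window has `q > 2/3 + 17p/3`, R16): the converse door is decorative there. [folklore] -/
theorem shell_threshold_shut_on_window {p q : ℝ} (hp : p < 1 / 3) (hq : 2 / 3 < q) :
    ¬ ∃ β0 : ℝ, ∀ β : ℝ, β0 ≤ β → 4 * (Fintype.card (Plaquette 3 L) : ℝ) * powScale p β ^ 2 < powScale q β := by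
  rw [shell_threshold_eventually_iff]
  linarith

end Threshold

end Summit.QuantumFields.YangMills.Theorems.TwistedTraceScaling.Negative.R22

end
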